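import Summits.BirchSwinnertonDyer.Rank1Residual.X10.SurjThreeShaCells
import Literature.NumberTheory.EllipticCurves.Rank1Residual.Typed.HigherDescentSelmerCertificate
import Literature.NumberTheory.EllipticCurves.BSDSelmerCMPConverseRankOneProofs
import HarnessLib

/-!
# Row D3 ∩ {r = 1}, the Ш-CELLS (good ordinary at `3`, `ρ̄_{E,3}` SURJECTIVE, analytic rank `1`, `#Ш_an = 9`)
# PER PAIR, FLAG-FREE — Miller's `BSD(E,3)` from Kato's Thm. 17.4 + Perrin-Riou–Schneider + the Schneider
# `3`-adic height certificate (UPPER half) + ONE exact `3`-descent `#Sel^(3)(E/ℚ) = 27` (LOWER half) + the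
# mod-`3` image DECIDED IN THE KERNEL
# (cell `b2b-bsdres`, unit `b2b-bsdres-x10` = X10 / N2 class lead, GEN 42; TOOL — theorems only, no definition, no named
# fact, nothing booked)

HONEST FRAMING (run/shared/lean/b2b/bsd-rank1-residual/, verbatim in every file): the goal of the
cell is to DELETE the COMBINATION-SHAPED residual classes of the Birch–Swinnerton-Dyer formula for
ALL analytic-rank `≤ 1` elliptic curves over `ℚ` — "full BSD formula for every rank `≤ 1` curve in
class `C`" assembled STRICTLY from published theorems — so that the rank-`≤ 1` remainder becomes
exactly the CONSTRUCTION-SHAPED classes, which are TYPED (missing-input `Prop`s), NOT attempted.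
This is not "finishing BSD".  X10a′ = X10 ∧ surj(3) is CLOSED (PUB*) AS A CLASS by Yan–Zhu 2026 Thm. 4.15 under
the register flag `YZ26@3-BF-ERL-Ohta` (row D3); THIS FILE books nothing and touches no class statement.
PARTITION (D-0054): D3 / X10a′ × p = 3 × r = 1 × #Ш_an = 9 — types-the-object-of; closes NONE.

## What (x10 GEN 42, X10-AUDIT §48)

The D3 census of this gen: of the 5 258 rank-`1` classes under `('YZ26', 3)`, 73 have `#Ш_an = 9` (the one road of
`X10/SurjThreePerPairKernelImage` needs `3 ∤ #Ш_an`).  For them the rank-`1` UPPER half is unchanged (Kato 17.4 (3) on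
the good-ordinary tower + Perrin-Riou–Schneider + Perrin-Riou 1987 + THE Schneider certificate:
`missingUpperBoundAt_three_rankOne_of_divisibility_classFree`), and the LOWER half comes from ONE exact `3`-descent:

* `nine_dvd_shaOrder_of_card_selmerThree_rankOne` — rank `1`, `E[3]` irreducible, `#Sel^(3)(E/ℚ) = 27` ⟹ `9 ∣ #Ш`
  (`#Sel^(3) = 3^{rank} · #E(ℚ)[3] · #Ш[3]`, Silverman X.4.2 (a): the tree's `card_torsionBy_sha_eq_of_card_selmerGroup`
  with `#E(ℚ)[3] = 1` from irreducibility, `natCard_torsionBy_eq_one_of_hasIrreducibleModPGaloisRep`);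
* `missingLowerBoundAt_three_of_card_selmerThree_rankOne` — the typed LOWER half at a rank-`1` pair with
  `ord₃ #Ш_an ≤ 2`;
* **`bsdp_three_rankOne_surj_shaCell_of_kato_of_schneider_of_card_selmerThree`** — `3` good ordinary, `ρ̄_{E,3}` onto,
  analytic rank `1`, `ord₃ #Ш_an ≤ 2`: Kato 17.4 (`hK`) + `hS` (A35) + `hPR` (F39) + `hmodP` (A19) + `hGZK` (A18) +
  `h3` (A25) + the Schneider certificate `hSch` + ONE exact `3`-descent `hcard : #Sel^(3) = 27` ⟹ Miller's `BSD(E,3)`;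
  NO Yan–Zhu, NO F1, NO `μ`-certificate, NO Cassels–Tate;
* `MuZeroRoad.bsdp_three_rankOne_shaCell_of_ainvs_of_surjWitnesses_of_kato_of_card_selmerThree` — the record shape
  off a literal integer model with good ordinary reduction at `3` AND surj(3) DECIDED in the kernel.

References: K. Kato, Astérisque 295 (2004) Thm. 17.4 (3) [Kato2004Asterisque]; C. Wuthrich, Doc. Math. 19 (2014)
Lemma 20 [Wuthrich2014]; B. Perrin-Riou, Invent. Math. 89 (1987) §1.4 Cor. 1.8 [PerrinRiou1987]; J. H. Silverman,
AEC (2009) Thm. X.4.2 (a) [SilvermanAEC2009]; B. Mazur, Publ. IHÉS 47 (1977) III §5 [Mazur1977]; J.-P. Serre,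
Invent. Math. 15 (1972) §2.4 Prop. 15 [Serre1972]; R. L. Miller, LMS J. Comput. Math. 14 (2011) Def. 1.1 [Miller2011LMS].
-/

set_option autoImplicit false

noncomputable section

open scoped Classical MatrixGroups ModularForm

open CongruenceSubgroup WeierstrassCurve Field Literature.NumberTheory.GaloisRepresentations
  Literature.NumberTheory.GaloisCohomology Literature.NumberTheory.EllipticCurves
  Literature.NumberTheory.EllipticCurves.ModularForms Literature.NumberTheory.EllipticCurves.Rank1Residual
  Literature.NumberTheory.EllipticCurves.Rank1Residual.Typed
  Literature.NumberTheory.EllipticCurves.Wuthrich2014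
  Literature.NumberTheory.EllipticCurves.Kato2004 Literature.NumberTheory.EllipticCurves.Kato2004.EulerSystemValues
  Literature.NumberTheory.EllipticCurves.Rank1Residual.X11RankOneCertificates
  Summit.BirchSwinnertonDyer.BirchSwinnertonDyer.Rank1Residual.IntModel
  Summit.BirchSwinnertonDyer.BirchSwinnertonDyer.Rank1Residual.X11RankOne
  Summit.BirchSwinnertonDyer.BirchSwinnertonDyer.Theorems.Rank1ResidualX1Defs
  Summit.BirchSwinnertonDyer.BirchSwinnertonDyer.Rank1Residual

namespace Summit.BirchSwinnertonDyer.Rank1Residual.X10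

section ShaCellRankOne

variable (W : WeierstrassCurve ℚ) [W.IsElliptic] [W.IsGloballyMinimal]

omit [W.IsGloballyMinimal] in
/-- **Rank `1`, `E[3]` irreducible, `#Sel^(3)(E/ℚ) = 27` ⟹ `9 ∣ #Ш(E/ℚ)`** (`#Ш := Nat.card Ш`; trivially true for
infinite `Ш`): `#Sel^(3) = 3^{rank} · #E(ℚ)[3] · #Ш[3]` (Silverman X.4.2 (a), the tree's
`card_torsionBy_sha_eq_of_card_selmerGroup`) with `#E(ℚ)[3] = 1` (irreducible `E[3]` has no rational line,
`natCard_torsionBy_eq_one_of_hasIrreducibleModPGaloisRep`) gives `#Ш[3] = 9`, and `Ш[3] ≤ Ш`.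
[cite: SilvermanAEC2009, Thm. X.4.2 (a)] [cite: Mazur1977, Ch. III §5, p. 157] -/
theorem nine_dvd_shaOrder_of_card_selmerThree_rankOne (hrank : W.mordellWeilRank = 1)
    (hirr : W.HasIrreducibleModPGaloisRep 3) (hcard : Nat.card (W.selmerGroup (3 : ℤ)) = 27) :
    9 ∣ W.shaOrder := by
  haveI : Fact (Nat.Prime 3) := ⟨by norm_num⟩
  have hT : Nat.card (AddSubgroup.torsionBy W.toAffine.Point ((3 : ℕ) : ℤ)) = 1 :=
    natCard_torsionBy_eq_one_of_hasIrreducibleModPGaloisRep W 3 hirr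
  have h9 : Nat.card (AddSubgroup.torsionBy W.sha (3 : ℕ)) = 9 :=
    card_torsionBy_sha_eq_of_card_selmerGroup W 3 (a := 3) (c := 9)
      (by
        -- the lemma is stated over a general number field `K`, where `E(K)`'s group law carries the
        -- classical `DecidableEq K`; transport `hT` (computable `DecidableEq ℚ`) to that instance
        -- (pattern of `Typed/X5DescentSelmerCore.lean`)
        have hinst : (instDecidableEqRat : DecidableEq ℚ) = fun a b => Classical.propDecidable (a = b) :=
          Subsingleton.elim _ _
        rw [hinst] at hT
        rw [hrank, pow_one, hT, mul_one])
      (by norm_num) (by exact_mod_cast hcard)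
  rw [WeierstrassCurve.shaOrder, ← h9]
  exact AddSubgroup.card_addSubgroup_dvd_card _

omit [W.IsGloballyMinimal] in
/-- **The typed LOWER half `ord₃ #Ш(E/ℚ)_an ≤ ord₃ #Ш(E/ℚ)` at a rank-`1` pair with `ord₃ #Ш_an ≤ 2` from ONE
exact `3`-descent `#Sel^(3)(E/ℚ) = 27`** — GZK gives rank `1` and `Ш` finite from analytic rank `1`; `E[3]`
irreducible; then `9 ∣ #Ш`.  No Cassels–Tate. [cite: SilvermanAEC2009, Thm. X.4.2 (a)]
[cite: Miller2011LMS, Def. 1.1 (arXiv:1010.2431 p. 3)] -/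
theorem missingLowerBoundAt_three_of_card_selmerThree_rankOne
    (hGZK : rank_eq_analyticRank_of_analyticRank_le_one) (hirr : W.HasIrreducibleModPGaloisRep 3)
    (hr1 : W.analyticRank = 1) (hcard : Nat.card (W.selmerGroup (3 : ℤ)) = 27)
    {q : ℚ} (hq : shaAn W = (q : ℂ)) (hv : padicValRat 3 q ≤ 2) : Typed.MissingLowerBoundAt W 3 := by
  haveI : Fact (Nat.Prime 3) := ⟨by norm_num⟩
  obtain ⟨hrk, hfin⟩ := hGZK W (by omega)
  have hrank : W.mordellWeilRank = 1 := hrk.trans hr1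
  have h9 : 9 ∣ W.shaOrder := nine_dvd_shaOrder_of_card_selmerThree_rankOne W hrank hirr hcard
  have hn : W.shaOrder ≠ 0 := (WeierstrassCurve.shaOrder_pos W hfin).ne'
  have hle : 2 ≤ padicValNat 3 W.shaOrder := by
    rw [← padicValNat_dvd_iff_le hn]; simpa using h9
  refine ⟨q, hq, hv.trans ?_⟩
  exact_mod_cast hle

/-- **D3 ∩ {r = 1} Ш-cell per pair, FLAG-FREE: `3` good ordinary, `ρ̄_{E,3}` onto, analytic rank `1`,
`ord₃ #Ш(E/ℚ)_an ≤ 2`: Kato's Thm. 17.4 ∧ the Schneider certificate ∧ ONE exact `3`-descent `#Sel^(3)(E/ℚ) = 27`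
⟹ Miller's `BSD(E,3)`.**  UPPER half `ord₃ #Ш ≤ ord₃ #Ш_an`: `divisibility_three_of_kato_of_surj` (Kato 17.4 (3) on
the good-ordinary tower; period unit `h3`) into GEN 41's class-free rank-one engine
`missingUpperBoundAt_three_rankOne_of_divisibility_classFree` (`hS` A35, `hPR` F39, `hmodP`, `hGZK`, σ discharged,
THE canonical height from `hSch`); LOWER half `missingLowerBoundAt_three_of_card_selmerThree_rankOne`; GZK assembles.
NO Yan–Zhu, NO F1, NO `μ`-certificate, NO Cassels–Tate; per pair; nothing booked.
[cite: Kato2004Asterisque, Thm. 17.4 (3) (p. 273)] [cite: Wuthrich2014, Lemma 20 (p. 399)]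
[cite: PerrinRiou1987, §1.4 Cor. 1.8] [cite: SilvermanAEC2009, Thm. X.4.2 (a)]
[cite: Miller2011LMS, Def. 1.1 (arXiv:1010.2431 p. 3)] -/
theorem bsdp_three_rankOne_surj_shaCell_of_kato_of_schneider_of_card_selmerThree
    (hK : ∀ (κ : ZpExtension ℚ 3) (γ : Field.absoluteGaloisGroup ℚ) [NeZero (W.conductorNorm ℤ)]
      (f : CuspForm (Gamma0 (W.conductorNorm ℤ)) 2), kato_divisibility W 3 (κ := κ) (γ := γ) (f := f))
    (hS : Schneider1985_order_charGenerator_odd) (hPR : perrinRiou_rankOne_leadingTerms_odd)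
    (hmodP : nonempty_modularParametrizationData)
    (hGZK : rank_eq_analyticRank_of_analyticRank_le_one)
    (h3 : realPeriodRat_eq_unit_mul_plusPeriod_three)
    (hgood : W.HasGoodReductionAtPrime 3) (hord : ¬ ((3 : ℕ) : ℤ) ∣ W.frobeniusTrace 3) (hsurj : Surj W 3)
    (hr1 : W.analyticRank = 1)
    (hSch : ∀ Dh : PAdicHeightData W 3, Dh.IsCanonical → SchneiderConjecture Dh)
    (hcard : Nat.card (W.selmerGroup (3 : ℤ)) = 27)
    {q : ℚ} (hq : shaAn W = (q : ℂ)) (hv : padicValRat 3 q ≤ 2) : BSDp W 3 := by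
  haveI : Fact (Nat.Prime 3) := ⟨by norm_num⟩
  have hirr : W.HasIrreducibleModPGaloisRep 3 :=
    hasIrreducibleModPGaloisRep_of_hasSurjectiveModNGaloisRep W 3 hsurj
  exact bsdp_of_missingPPartAt W 3 hGZK hr1.le (missingPPartAt_of_lower_of_upper W 3
    (missingLowerBoundAt_three_of_card_selmerThree_rankOne W hGZK hirr hr1 hcard hq hv)
    (missingUpperBoundAt_three_rankOne_of_divisibility_classFree W hS hPR hmodP hGZK hgood hord hr1 hSch
      (divisibility_three_of_kato_of_surj W h3 hK hgood hord hsurj)))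

end ShaCellRankOne

namespace MuZeroRoad

/-- **D3 ∩ {r = 1} Ш-cell record shape with the IMAGE DECIDED IN THE KERNEL: Kato 17.4 ∧ Schneider certificate ∧
`#Sel^(3)(E/ℚ) = 27` ∧ `ord₃ #Ш_an ≤ 2` ⟹ Miller's `BSD(E,3)` for a cell given by a literal integer model** — good
ORDINARY at `3` (`3 ∤ Δ`, `countPoints … 3 = n₃`, `3 ∤ 4 − n₃`) and `ρ̄_{E,3}` onto (two Frobenius witnesses) READ OFF
the model; displayed: `hkato` (Kato 17.4, uniform shape), PUBLISHED `hS` `hPR` `hmodP` `hGZK` `h3`, census `hr1`,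
`hq`/`hv`, certificates `hSch` (two-engine `3`-adic height) and `hcard` (one two-engine exact `3`-descent).
FLAG-FREE; per pair; nothing booked. [cite: Kato2004Asterisque, Thm. 17.4 (3) (p. 273)]
[cite: SilvermanAEC2009, Thm. X.4.2 (a)] [cite: Serre1972, §2.4 Prop. 15, §2.8]
[cite: Miller2011LMS, Def. 1.1 (arXiv:1010.2431 p. 3)] -/
theorem bsdp_three_rankOne_shaCell_of_ainvs_of_surjWitnesses_of_kato_of_card_selmerThree
    (hkato : ∀ (W : WeierstrassCurve ℚ) [W.IsElliptic] [W.IsGloballyMinimal] (p : ℕ) [Fact p.Prime]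
      (κ : ZpExtension ℚ p) (γ : Field.absoluteGaloisGroup ℚ) (N : ℕ) [NeZero N]
      (f : CuspForm (Gamma0 N) 2), kato_divisibility W p (κ := κ) (γ := γ) (f := f))
    (hS : Schneider1985_order_charGenerator_odd) (hPR : perrinRiou_rankOne_leadingTerms_odd)
    (hmodP : nonempty_modularParametrizationData)
    (hGZK : rank_eq_analyticRank_of_analyticRank_le_one)
    (h3 : realPeriodRat_eq_unit_mul_plusPeriod_three)
    (a1 a2 a3 a4 a6 : ℤ) {W : WeierstrassCurve ℚ} [W.IsElliptic] [W.IsGloballyMinimal]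
    (hW : integralModelInt W = ⟨a1, a2, a3, a4, a6⟩)
    (ℓ₁ n₁ ℓ₂ n₂ n3 : ℕ) [Fact ℓ₁.Prime] [Fact ℓ₂.Prime]
    (h3Δ : ¬ (3 : ℤ) ∣ discOf [a1, a2, a3, a4, a6])
    (hc3 : countPoints [a1, a2, a3, a4, a6] 3 = n3) (hord3 : ¬ (3 : ℤ) ∣ (3 : ℤ) + 1 - n3)
    (hℓ₁2 : ℓ₁ ≠ 2) (hℓ₁3 : ℓ₁ ≠ 3) (hℓ₁Δ : ¬ (ℓ₁ : ℤ) ∣ discOf [a1, a2, a3, a4, a6])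
    (hc₁ : countPoints [a1, a2, a3, a4, a6] ℓ₁ = n₁)
    (hnoroot : ∀ t : ℕ, t < 3 → ¬ (3 : ℤ) ∣ (t : ℤ) ^ 2 - ((ℓ₁ : ℤ) + 1 - n₁) * t + ℓ₁)
    (hℓ₂2 : ℓ₂ ≠ 2) (hℓ₂3 : ℓ₂ ≠ 3) (hℓ₂Δ : ¬ (ℓ₂ : ℤ) ∣ discOf [a1, a2, a3, a4, a6])
    (hc₂ : countPoints [a1, a2, a3, a4, a6] ℓ₂ = n₂)
    (hdet₂ : (ℓ₂ : ZMod 3) = 1) (htr₂ : (((ℓ₂ : ℤ) + 1 - n₂ : ℤ) : ZMod 3) = 2) (hsq : ¬ 9 ∣ n₂)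
    (hr1 : W.analyticRank = 1)
    (hSch : ∀ Dh : PAdicHeightData W 3, Dh.IsCanonical → SchneiderConjecture Dh)
    (hcard : Nat.card (W.selmerGroup (3 : ℤ)) = 27)
    {q : ℚ} (hq : shaAn W = (q : ℂ)) (hv : padicValRat 3 q ≤ 2) : BSDp W 3 := by
  haveI : Fact (Nat.Prime 3) := ⟨by norm_num⟩
  obtain ⟨hgood, hord, -⟩ := goodOrdIrr_three_of_ainvs_of_countPoints a1 a2 a3 a4 a6 hW ℓ₁ n₁ n3 h3Δ hc3
    hord3 hℓ₁2 hℓ₁3 hℓ₁Δ hc₁ hnoroot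
  exact bsdp_three_rankOne_surj_shaCell_of_kato_of_schneider_of_card_selmerThree W
    (fun κ γ _ f ↦ hkato W 3 κ γ (W.conductorNorm ℤ) f) hS hPR hmodP hGZK h3 hgood hord
    (surj_three_of_ainvs_of_witnesses a1 a2 a3 a4 a6 hW ℓ₁ n₁ ℓ₂ n₂ hℓ₁2 hℓ₁3 hℓ₁Δ hc₁ hnoroot hℓ₂2 hℓ₂3
      hℓ₂Δ hc₂ hdet₂ htr₂ hsq) hr1 hSch hcard hq hv

end MuZeroRoad

end Summit.BirchSwinnertonDyer.Rank1Residual.X10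

end
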